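/-
Copyright (c) 2026. All rights reserved.
Released under Apache 2.0 license as described in the file LICENSE.
Authors: abc-iut cell, seat abc-iut-w5-d218 (gen 3).
-/
import Literature.GroupTheory.ProPDerivedClosed
import Mathlib.GroupTheory.FiniteAbelian.Basic

/-!
# The subgroup `[M,M]·Mᵖ` of a topologically finitely generated pro-`p` group is open

J. D. Dixon, M. du Sautoy, A. Mann, D. Segal, *Analytic pro-`p` groups* (2nd ed.), Prop. 1.16 (iii) with
Cor. 1.20: for a topologically finitely generated pro-`p` group `M` the ABSTRACT subgroup
`Φ := [M, M] · Mᵖ` generated by all commutators and all `p`-th powers (Mathlib: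
`commutator M ⊔ Subgroup.closure (Set.range fun x ↦ x ^ p)`) is open.  Proof, given that `[M, M]` is
compact (`ProPDerivedClosed.lean`, DdSMS Prop. 1.19): every element of `Φ` is `y ^ p * c` with
`c ∈ [M, M]` (compute in the abelian group `M ⧸ [M, M]`), so `Φ = {y ^ p} · [M, M]` is compact, hence
closed; and `Φ` has finite index: if `D` is a dense finitely generated subgroup, `D ⧸ (D ∩ Φ)` is a
finitely generated abelian torsion group, hence finite, so `D · Φ` is a finite union of cosets of `Φ`,
closed and dense, i.e. `D · Φ = M`.  A closed subgroup of finite index is open.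

Vocabulary as in `ProPPowerMap.lean` (Mathlib only, hypotheses spelled out, no definitions).
* `coe_commutator_sup_closure_pow` — `[M,M]·Mⁿ = {yⁿ} · [M,M]` as sets (any group, any `n`);
* `finiteIndex_of_isClosed_of_dense` — a closed subgroup meeting a dense subgroup in finite index has
  finite index;
* `finiteIndex_subgroupOf_closure_of_commutator_le` — `D ∩ Φ` has finite index in a finitely generated
  `D` whenever `Φ ⊇ [M,M]` contains all `n`-th powers (`n ≥ 1`);
* `isOpen_commutator_sup_closure_pow_of_proP` — DdSMS Prop. 1.16 (iii)/Cor. 1.20.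

[cite: DDMSAnalyticProP1999, Prop 1.16 (iii), Cor 1.20]
-/

namespace Literature.GroupTheory

open scoped Pointwise commutatorElement

section General

variable {M : Type*} [Group M]

/-- `M ⧸ [M,M]` is commutative. [cite: DDMSAnalyticProP1999, §1.2] -/
theorem mk_mul_mk_comm_commutator (a b : M) :
    (QuotientGroup.mk a : M ⧸ commutator M) * QuotientGroup.mk b =
      QuotientGroup.mk b * QuotientGroup.mk a := by
  rw [← QuotientGroup.mk_mul, ← QuotientGroup.mk_mul, QuotientGroup.eq]
  have : (a * b)⁻¹ * (b * a) = ⁅b⁻¹, a⁻¹⁆ := by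
    simp only [commutatorElement_def, mul_inv_rev, inv_inv, mul_assoc]
  rw [this]
  exact Subgroup.commutator_mem_commutator (Subgroup.mem_top _) (Subgroup.mem_top _)

/-- A subgroup containing `[M,M]` is normal. [cite: DDMSAnalyticProP1999, §1.2] -/
theorem normal_of_commutator_le {F : Subgroup M} (h : commutator M ≤ F) : F.Normal := by
  refine ⟨fun f hf g => ?_⟩
  have hid : g * f * g⁻¹ = ⁅g, f⁆ * f := by
    simp only [commutatorElement_def, mul_assoc, inv_mul_cancel, mul_one]
  rw [hid]
  exact mul_mem (h (Subgroup.commutator_mem_commutator (Subgroup.mem_top g) (Subgroup.mem_top f))) hf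

/-- In `M ⧸ [M,M]` every element of the subgroup generated by the `n`-th powers is an `n`-th power
(the `n`-th powers of an abelian group form a subgroup). [cite: DDMSAnalyticProP1999, Prop 1.16 (iii)] -/
theorem exists_mk_eq_mk_pow_of_mem_closure_pow (n : ℕ) {q : M}
    (hq : q ∈ Subgroup.closure (Set.range fun x : M => x ^ n)) :
    ∃ y : M, (QuotientGroup.mk q : M ⧸ commutator M) = QuotientGroup.mk (y ^ n) := by
  induction hq using Subgroup.closure_induction with
  | mem x hx =>
    obtain ⟨y, rfl⟩ := hx
    exact ⟨y, rfl⟩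
  | one => exact ⟨1, by rw [one_pow]⟩
  | mul q q' _ _ ih ih' =>
    obtain ⟨y, hy⟩ := ih
    obtain ⟨y', hy'⟩ := ih'
    refine ⟨y * y', ?_⟩
    rw [QuotientGroup.mk_mul, hy, hy', QuotientGroup.mk_pow, QuotientGroup.mk_pow,
      QuotientGroup.mk_pow, QuotientGroup.mk_mul,
      Commute.mul_pow (mk_mul_mk_comm_commutator y y') n]
  | inv q _ ih =>
    obtain ⟨y, hy⟩ := ih
    refine ⟨y⁻¹, ?_⟩
    rw [QuotientGroup.mk_inv, hy, inv_pow, QuotientGroup.mk_inv]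

/-- In any group, every element of `[M,M]·Mⁿ := [M,M] ⊔ ⟨yⁿ⟩` is of the form `yⁿ · c` with `c ∈ [M,M]`
(compute in the abelian quotient `M ⧸ [M,M]`, where `n`-th powers form a subgroup):
`[M,M]·Mⁿ = {yⁿ} · [M,M]` as sets. [cite: DDMSAnalyticProP1999, Prop 1.16 (iii)] -/
theorem coe_commutator_sup_closure_pow (n : ℕ) :
    ((commutator M ⊔ Subgroup.closure (Set.range fun x : M => x ^ n) : Subgroup M) : Set M) =
      Set.range (fun x : M => x ^ n) * (commutator M : Set M) := by
  refine Set.Subset.antisymm ?_ ?_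
  · intro g hg
    -- `g ≡ yⁿ (mod [M,M])` for some `y`
    have key : ∃ y : M, (QuotientGroup.mk g : M ⧸ commutator M) = QuotientGroup.mk (y ^ n) := by
      obtain ⟨c, hc, q, hq, rfl⟩ := Subgroup.mem_sup_of_normal_left.mp hg
      have hcq : (QuotientGroup.mk (c * q) : M ⧸ commutator M) = QuotientGroup.mk q := by
        rw [QuotientGroup.mk_mul, (QuotientGroup.eq_one_iff c).mpr hc, one_mul]
      rw [hcq]
      exact exists_mk_eq_mk_pow_of_mem_closure_pow n hq
    obtain ⟨y, hy⟩ := key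
    have hmem : (y ^ n)⁻¹ * g ∈ commutator M := QuotientGroup.eq.mp hy.symm
    exact Set.mem_mul.mpr ⟨y ^ n, ⟨y, rfl⟩, (y ^ n)⁻¹ * g, hmem, mul_inv_cancel_left _ _⟩
  · rintro _ ⟨_, ⟨y, rfl⟩, c, hc, rfl⟩
    exact mul_mem (Subgroup.mem_sup_right (Subgroup.subset_closure ⟨y, rfl⟩))
      (Subgroup.mem_sup_left hc)

/-- In a finitely generated group `D`, a subgroup `N` containing `[D,D]` (through the ambient group:
`N = Φ ∩ D` with `[M,M] ≤ Φ`) and all `n`-th powers, `n ≥ 1`, has finite index: `D ⧸ N` is a finitely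
generated abelian torsion group. [cite: DDMSAnalyticProP1999, Prop 1.16 (iii)] -/
theorem finiteIndex_subgroupOf_closure_of_commutator_le (S : Finset M) (F : Subgroup M)
    (hcomm : commutator M ≤ F) {n : ℕ} (hn : 0 < n) (hpow : ∀ x : M, x ^ n ∈ F) :
    (F.subgroupOf (Subgroup.closure (S : Set M))).FiniteIndex := by
  set D : Subgroup M := Subgroup.closure (S : Set M)
  set N : Subgroup D := F.subgroupOf D
  haveI hFn : F.Normal := normal_of_commutator_le hcomm
  haveI hNn : N.Normal := by
    refine ⟨fun x hx g => ?_⟩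
    simp only [N, Subgroup.mem_subgroupOf, Subgroup.coe_mul, Subgroup.coe_inv] at hx ⊢
    exact hFn.conj_mem _ hx _
  -- `D ⧸ N` is a finitely generated commutative torsion group, hence finite
  have hcommQ : ∀ a b : D ⧸ N, a * b = b * a := by
    intro a b
    induction a using QuotientGroup.induction_on with
    | H x =>
      induction b using QuotientGroup.induction_on with
      | H y =>
        rw [← QuotientGroup.mk_mul, ← QuotientGroup.mk_mul, QuotientGroup.eq]
        simp only [N, Subgroup.mem_subgroupOf, Subgroup.coe_mul, Subgroup.coe_inv]
        have : ((x : M) * y)⁻¹ * ((y : M) * x) = ⁅(y : M)⁻¹, (x : M)⁻¹⁆ := by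
          simp only [commutatorElement_def, mul_inv_rev, inv_inv, mul_assoc]
        rw [this]
        exact hcomm (Subgroup.commutator_mem_commutator (Subgroup.mem_top _) (Subgroup.mem_top _))
  letI : CommGroup (D ⧸ N) := { (inferInstance : Group (D ⧸ N)) with mul_comm := hcommQ }
  have htors : Monoid.IsTorsion (D ⧸ N) := by
    intro a
    induction a using QuotientGroup.induction_on with
    | H x =>
      refine isOfFinOrder_iff_pow_eq_one.mpr ⟨n, hn, ?_⟩
      rw [← QuotientGroup.mk_pow, QuotientGroup.eq_one_iff]
      simp only [N, Subgroup.mem_subgroupOf, Subgroup.coe_pow]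
      exact hpow _
  haveI : Finite (D ⧸ N) := CommGroup.finite_of_fg_torsion (D ⧸ N) htors
  exact Subgroup.finiteIndex_of_finite_quotient

variable [TopologicalSpace M] [IsTopologicalGroup M]

/-- A CLOSED subgroup `F` of a topological group that meets a DENSE subgroup `D` in a subgroup of
finite index of `D` has finite index: `D · F` is a finite union of cosets of `F`, hence closed, and
dense, hence everything. [cite: DDMSAnalyticProP1999, Prop 1.16 (iii)] -/
theorem finiteIndex_of_isClosed_of_dense (F : Subgroup M) (hF : IsClosed (F : Set M))
    (D : Subgroup M) (hD : Dense (D : Set M)) [hfi : (F.subgroupOf D).FiniteIndex] :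
    F.FiniteIndex := by
  set N : Subgroup D := F.subgroupOf D
  haveI : Finite (D ⧸ N) := Subgroup.finite_quotient_of_finiteIndex
  -- the finite union of cosets `q.out • F`, `q ∈ D ⧸ N`
  set E : Set M := ⋃ q : D ⧸ N, ((q.out : D) : M) • (F : Set M) with hE
  have hEc : IsClosed E := isClosed_iUnion_of_finite fun q => hF.smul _
  have hDE : (D : Set M) ⊆ E := by
    intro d hd
    obtain ⟨h, hh⟩ := QuotientGroup.mk_out_eq_mul N ⟨d, hd⟩
    refine Set.mem_iUnion.mpr ⟨QuotientGroup.mk ⟨d, hd⟩, ?_⟩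
    refine Set.mem_smul_set.mpr ⟨((h : D) : M)⁻¹, ?_, ?_⟩
    · exact inv_mem (Subgroup.mem_subgroupOf.mp h.2)
    · rw [hh, Subgroup.coe_mul, smul_eq_mul, mul_inv_cancel_right]
  have hEuniv : E = Set.univ := by
    rw [← hEc.closure_eq]
    exact (hD.mono hDE).closure_eq
  -- so `q ↦ mk q.out` is onto `M ⧸ F`
  haveI : Finite (M ⧸ F) := by
    refine Finite.of_surjective (fun q : D ⧸ N => (QuotientGroup.mk ((q.out : D) : M) : M ⧸ F))
      fun x => ?_
    induction x using QuotientGroup.induction_on with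
    | H m =>
      have hm : m ∈ E := hEuniv ▸ Set.mem_univ m
      obtain ⟨q, hq⟩ := Set.mem_iUnion.mp hm
      obtain ⟨f, hf, rfl⟩ := Set.mem_smul_set.mp hq
      refine ⟨q, ?_⟩
      dsimp only
      rw [smul_eq_mul, QuotientGroup.eq, inv_mul_cancel_left]
      exact hf
  exact Subgroup.finiteIndex_of_finite_quotient

end General

section ProP

variable {M : Type*} [Group M] [TopologicalSpace M] [IsTopologicalGroup M] [CompactSpace M]
  [TotallyDisconnectedSpace M] {p : ℕ} [Fact p.Prime]

/-- In a topologically finitely generated pro-`p` group, `[M,M]·Mᵖ = {yᵖ} · [M,M]` is compact, hence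
CLOSED. [cite: DDMSAnalyticProP1999, Prop 1.16 (iii)] -/
theorem isClosed_commutator_sup_closure_pow_of_proP
    (hP : ∀ U : OpenNormalSubgroup M, IsPGroup p (M ⧸ (U : Subgroup M)))
    (hfg : ∃ S : Finset M, Dense ((Subgroup.closure (S : Set M) : Subgroup M) : Set M)) :
    IsClosed ((commutator M ⊔ Subgroup.closure (Set.range fun x : M => x ^ p) : Subgroup M) :
      Set M) := by
  rw [coe_commutator_sup_closure_pow]
  exact ((isCompact_range (continuous_pow p)).mul (isCompact_commutator_of_proP hP hfg)).isClosed

/-- In a topologically finitely generated pro-`p` group, `[M,M]·Mᵖ` has finite index.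
[cite: DDMSAnalyticProP1999, Prop 1.16 (iii)] -/
theorem finiteIndex_commutator_sup_closure_pow_of_proP
    (hP : ∀ U : OpenNormalSubgroup M, IsPGroup p (M ⧸ (U : Subgroup M)))
    (hfg : ∃ S : Finset M, Dense ((Subgroup.closure (S : Set M) : Subgroup M) : Set M)) :
    (commutator M ⊔ Subgroup.closure (Set.range fun x : M => x ^ p) : Subgroup M).FiniteIndex := by
  obtain ⟨S, hS⟩ := hfg
  haveI := finiteIndex_subgroupOf_closure_of_commutator_le S
    (commutator M ⊔ Subgroup.closure (Set.range fun x : M => x ^ p)) le_sup_left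
    (Fact.out : p.Prime).pos fun x => Subgroup.mem_sup_right (Subgroup.subset_closure ⟨x, rfl⟩)
  exact finiteIndex_of_isClosed_of_dense _ (isClosed_commutator_sup_closure_pow_of_proP hP ⟨S, hS⟩)
    (Subgroup.closure (S : Set M)) hS

/-- **DdSMS Prop. 1.16 (iii) / Cor. 1.20.** In a topologically finitely generated pro-`p` group the
abstract subgroup `[M,M]·Mᵖ` generated by all commutators and `p`-th powers is OPEN (it is closed of
finite index; it is the Frattini subgroup, though that identification is not needed here).
[cite: DDMSAnalyticProP1999, Prop 1.16 (iii), Cor 1.20] -/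
theorem isOpen_commutator_sup_closure_pow_of_proP
    (hP : ∀ U : OpenNormalSubgroup M, IsPGroup p (M ⧸ (U : Subgroup M)))
    (hfg : ∃ S : Finset M, Dense ((Subgroup.closure (S : Set M) : Subgroup M) : Set M)) :
    IsOpen ((commutator M ⊔ Subgroup.closure (Set.range fun x : M => x ^ p) : Subgroup M) :
      Set M) := by
  haveI := finiteIndex_commutator_sup_closure_pow_of_proP hP hfg
  exact Subgroup.isOpen_of_isClosed_of_finiteIndex _
    (isClosed_commutator_sup_closure_pow_of_proP hP hfg)

end ProP

end Literature.GroupTheory
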